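import Summits.QuantumFields.YangMills.Theorems.SwapVirialDeficitBlowUpGnomonicTrFibreDefs
import Summits.QuantumFields.YangMills.Theorems.SwapVirialDeficitBlowUpGnomonicBFibreRescaled
import Summits.QuantumFields.YangMills.Theorems.SwapVirialDeficitBlowUpGnomonicTrGlobalFloor
import HarnessLib

/-!
# Route `SwapVirialDeficit` (YangMills): THE E1-RESCALED 001 FIBRE — `x`-fibre letters `× √(1+u₁²)`, `y_⊥ × √(1+u₂²)`; the amplitude factorises into the integrable
# base weight `(1+u₁²)⁻¹(1+u₂²)⁻¹` and a `u`-free fibre weight (definitions + API; cell ym-idea-1, twin of w2 g59's ✓`…BlowUpGnomonicBFibreRescaled` for the 001 chart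
# ✓`gnoFibreTrEquiv` of ⧗`…BlowUpGnomonicTrFibreDefs`; letters of w3 g67's ✓`tr001_global_floor` ∕ LEAD g99 21:56Z «Jacobian (1+x′₁²)(1+y₀²)»; assembler fcl-p3 g48)

w3 g67's global floor of sector 001 (✓`tr001_global_floor`, ✓`tr001_far_floor`) is stated in the RESCALED fibre letters `(x₀, w∕√(1+y₀²))∕√(1+v²)`, `y_⊥∕√(1+y₀²)`
(`v = u₁`, `y₀ = u₂` the base of ✓`gnoFibreTrEquiv`): in these letters the 001 valley is UNIFORMLY non-degenerate over the whole base `ℝ²`.  This file is the 001 twin of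
✓`…BFibreRescaled` §1, §2, §4:
* §1 `gnoFibreTrScale u` (`√(1+u₁²)` on the two transverse `x`-fibre slots `t1, t2`, `√(1+u₂²)` on `y_⊥`, `1` on `δ`, `z`, followers), `gnoScaleTr u y`, `gnoScaleTrLin u`
  (+ positivity, `≥ 1`, measurability, ★ `prod_gnoFibreTrScale = (1+u₁²)(1+u₂²)` — the Jacobian, symmetry, `‖y‖ ≤ ‖gnoScaleTr u y‖`);
* §2 the letters of the rescaled chart point `gnoFibreTrEquiv (u, gnoScaleTr u y)` and of the direction `gnoFibreTrEmb u.2 (gnoScaleTr u y)`;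
* §3 the amplitude: `gnomonicWeight_trRescaledX` ∕ `…Y` (the leader weights FACTORISE: `1 + |x|² = (1+u₁²)(1+t₁²+t₂²)`, `1 + |y|² = (1+u₂²)(1+|v|²)`),
  ★ `trDensity_rescaled_eq` (`J(Ψ(u, gnoScaleTr u y)) = w(0,u₁,0)·w(u₂,0,0)·g(y)` with the `u`-FREE fibre weight `g`), `trFibreWeight_bounds` (`1 − 2‖y‖² ≤ g(y) ≤ 1`, `0 < g`),
  ★ `trBaseWeight_facts` (`w₀(u) = w(0,u₁,0)·w(u₂,0,0)·(1+u₁²)(1+u₂²) = (1+u₁²)⁻¹(1+u₂²)⁻¹`: positive, measurable, INTEGRABLE on `ℝ²`);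
* §4 ★ `tr001_rescaledNormSq_eq` (w3 g67's rescaled fibre norm of ✓`tr001_global_floor` IS `‖y‖²` at `Ψ(u, gnoScaleTr u y)`), ★★ `tr001_hfar_rescaled` — the FAR-FLOOR SOCKET
  `R ≤ ‖y‖ ⟹ R²∕(10816(1+|Fol L|)L⁶) ≤ F̂₁(Ψ(u, gnoScaleTr u y))` for every base point and sign pattern (✓`tr001_far_floor`).

HONEST LABEL: definitions and real∕measure-theoretic API only (reviewed Defs file of the route's posited objects); the 001 fibred law (`stub_h001_good`), its Hessian∕cubic data,
(S-core-tip), (S-core-end), ⟨24197⟩ ∕ ⟨24194⟩ OPEN; item of record ⟨24085⟩ SubOctaveBounded aside ∕ untouched; the Yang–Mills mass gap is NOT proved; no summit is proved by a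
line.  No instance, no notation, 0 `sorry`, standard axioms.  Seat ym-line-fcl-p3 g48 (cell ym-idea-1, free hands), `--supports stmt-QuantumFields-24197`.
References: [cite: Luscher1983, §2]; [cite: Breitung1994, §2.3 Definitions 4–5]; [folklore].
-/

set_option autoImplicit false
set_option synthInstance.maxSize 1024

noncomputable section

open MeasureTheory Set
open scoped BigOperators ENNReal InnerProductSpace

namespace Summit.QuantumFields.YangMills.Theorems.SwapVirialDeficit.BlowUpRing

open Summit.QuantumFields.YangMills.Theorems.FemtoTransferGap
open Summit.QuantumFields.YangMills.Theorems.SwapVirialDeficit.Gnomonic (normSq3 normSq3_nonneg gnomonicWeight gnomonicWeight_pos gnomonicWeight_le_one piWeight piWeight_pos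
  piWeight_le_one)
open Summit.QuantumFields.YangMills.Theorems.SwapVirialDeficit.SectorLaplace (z₁ uJ sectorChar)

variable {L : ℕ} [NeZero L]

/-! ## §1 The weight and the rescaled 001 fibre vector -/

/-- THE 001 RESCALING WEIGHT over the base `u = (u₁, u₂)`: `√(1+u₁²)` on the transverse `x`-fibre slots `t1, t2` (indices `inl (inl 1)`, `inl (inl 2)`), `√(1+u₂²)` on
`y_⊥` (indices `inl (inr ·)`), `1` on `δ`, `z` and the followers. [folklore] -/
def gnoFibreTrScale (u : ℝ × ℝ) : GnoFibreBIdx L → ℝ :=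
  Sum.elim (Sum.elim (![1, Real.sqrt (1 + u.1 ^ 2), Real.sqrt (1 + u.1 ^ 2)] : Fin 3 → ℝ) (fun _ : Fin 2 => Real.sqrt (1 + u.2 ^ 2)))
    (Sum.elim (fun _ : Fin 3 => (1 : ℝ)) (fun _ : Fol L × Fin 3 => (1 : ℝ)))

/-- THE RESCALED 001 FIBRE VECTOR `gnoScaleTr u y = (gnoFibreTrScale u i · y_i)_i`. [folklore] -/
def gnoScaleTr (u : ℝ × ℝ) (y : GnoFibreB L) : GnoFibreB L := WithLp.toLp 2 fun i => gnoFibreTrScale (L := L) u i * y i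

/-- The 001 rescaling as a linear map of the fibre. [folklore] -/
def gnoScaleTrLin (u : ℝ × ℝ) : GnoFibreB L →ₗ[ℝ] GnoFibreB L where
  toFun := gnoScaleTr u
  map_add' y y' := PiLp.ext fun i => by simp only [gnoScaleTr, PiLp.toLp_apply, PiLp.add_apply]; ring
  map_smul' c y := PiLp.ext fun i => by simp only [gnoScaleTr, PiLp.toLp_apply, PiLp.smul_apply, smul_eq_mul, RingHom.id_apply]; ring

omit [NeZero L] in
/-- The weights, index by index. [folklore] -/
theorem gnoFibreTrScale_apply (u : ℝ × ℝ) :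
    gnoFibreTrScale (L := L) u (Sum.inl (Sum.inl 0)) = 1 ∧ gnoFibreTrScale (L := L) u (Sum.inl (Sum.inl 1)) = Real.sqrt (1 + u.1 ^ 2) ∧
      gnoFibreTrScale (L := L) u (Sum.inl (Sum.inl 2)) = Real.sqrt (1 + u.1 ^ 2) ∧ (∀ j, gnoFibreTrScale (L := L) u (Sum.inl (Sum.inr j)) = Real.sqrt (1 + u.2 ^ 2)) ∧
      (∀ k, gnoFibreTrScale (L := L) u (Sum.inr (Sum.inl k)) = 1) ∧ ∀ fk, gnoFibreTrScale (L := L) u (Sum.inr (Sum.inr fk)) = 1 := by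
  refine ⟨rfl, rfl, rfl, fun j => rfl, fun k => rfl, fun fk => rfl⟩

omit [NeZero L] in
/-- Every weight is `≥ 1`. [folklore] -/
theorem one_le_gnoFibreTrScale (u : ℝ × ℝ) (i : GnoFibreBIdx L) : 1 ≤ gnoFibreTrScale (L := L) u i := by
  obtain ⟨h0, h1, h2, hj, hk, hf⟩ := gnoFibreTrScale_apply (L := L) u
  have hs1 : 1 ≤ Real.sqrt (1 + u.1 ^ 2) := Real.one_le_sqrt.2 (by nlinarith [sq_nonneg u.1])
  have hs2 : 1 ≤ Real.sqrt (1 + u.2 ^ 2) := Real.one_le_sqrt.2 (by nlinarith [sq_nonneg u.2])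
  rcases i with ((j | j) | (k | fk))
  · fin_cases j
    · exact h0 ▸ le_rfl
    · exact hs1
    · exact hs1
  · exact (hj j) ▸ hs2
  · exact (hk k) ▸ le_rfl
  · exact (hf fk) ▸ le_rfl

omit [NeZero L] in
/-- Every weight is positive. [folklore] -/
theorem gnoFibreTrScale_pos (u : ℝ × ℝ) (i : GnoFibreBIdx L) : 0 < gnoFibreTrScale (L := L) u i :=
  lt_of_lt_of_le one_pos (one_le_gnoFibreTrScale u i)

omit [NeZero L] in
/-- Coordinates of the rescaled vector. [folklore] -/
theorem gnoScaleTr_apply (u : ℝ × ℝ) (y : GnoFibreB L) (i : GnoFibreBIdx L) : gnoScaleTr u y i = gnoFibreTrScale (L := L) u i * y i := rfl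

omit [NeZero L] in
/-- The rescaling commutes with scalars. [folklore] -/
theorem gnoScaleTr_smul (u : ℝ × ℝ) (t : ℝ) (y : GnoFibreB L) : gnoScaleTr u (t • y) = t • gnoScaleTr u y :=
  PiLp.ext fun i => by simp only [gnoScaleTr, PiLp.toLp_apply, PiLp.smul_apply, smul_eq_mul]; ring

omit [NeZero L] in
/-- The rescaling of `0` is `0`. [folklore] -/
theorem gnoScaleTr_zero (u : ℝ × ℝ) : gnoScaleTr u (0 : GnoFibreB L) = 0 :=
  PiLp.ext fun i => by simp only [gnoScaleTr, PiLp.toLp_apply, PiLp.zero_apply, mul_zero]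

omit [NeZero L] in
/-- The linear map is the rescaling. [folklore] -/
theorem gnoScaleTrLin_apply (u : ℝ × ℝ) (y : GnoFibreB L) : gnoScaleTrLin u y = gnoScaleTr u y := rfl

omit [NeZero L] in
/-- The weights are measurable in the base point. [folklore] -/
theorem measurable_gnoFibreTrScale (i : GnoFibreBIdx L) : Measurable fun u : ℝ × ℝ => gnoFibreTrScale (L := L) u i := by
  have hc1 : Measurable fun u : ℝ × ℝ => Real.sqrt (1 + u.1 ^ 2) := (measurable_const.add (measurable_fst.pow_const 2)).sqrt
  have hc2 : Measurable fun u : ℝ × ℝ => Real.sqrt (1 + u.2 ^ 2) := (measurable_const.add (measurable_snd.pow_const 2)).sqrt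
  rcases i with ((j | j) | (k | fk))
  · fin_cases j
    · exact measurable_const
    · exact hc1
    · exact hc1
  · exact hc2
  · exact measurable_const
  · exact measurable_const

omit [NeZero L] in
/-- `(u, y) ↦ gnoScaleTr u y` is jointly measurable. [folklore] -/
theorem measurable_gnoScaleTr_prod : Measurable fun q : (ℝ × ℝ) × GnoFibreB L => gnoScaleTr (L := L) q.1 q.2 := by
  refine (WithLp.measurable_toLp 2 _).comp (measurable_pi_lambda _ fun i => ?_)
  exact ((measurable_gnoFibreTrScale i).comp measurable_fst).mul ((measurable_pi_apply i).comp ((WithLp.measurable_ofLp 2 _).comp measurable_snd))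

/-- ★ The Jacobian of the 001 rescaling: `Π_i gnoFibreTrScale u i = (1+u₁²)(1+u₂²)`. [folklore] -/
theorem prod_gnoFibreTrScale (u : ℝ × ℝ) : ∏ i, gnoFibreTrScale (L := L) u i = (1 + u.1 ^ 2) * (1 + u.2 ^ 2) := by
  rw [Fintype.prod_sum_type, Fintype.prod_sum_type, Fintype.prod_sum_type, Fin.prod_univ_three, Fin.prod_univ_two]
  have h1 : Real.sqrt (1 + u.1 ^ 2) * Real.sqrt (1 + u.1 ^ 2) = 1 + u.1 ^ 2 := Real.mul_self_sqrt (by positivity)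
  have h2 : Real.sqrt (1 + u.2 ^ 2) * Real.sqrt (1 + u.2 ^ 2) = 1 + u.2 ^ 2 := Real.mul_self_sqrt (by positivity)
  simp only [gnoFibreTrScale, Sum.elim_inl, Sum.elim_inr, Matrix.cons_val_zero, Matrix.cons_val_one, Matrix.cons_val_two, Matrix.head_cons, Matrix.tail_cons,
    Finset.prod_const_one, mul_one, one_mul]
  rw [← mul_assoc, h1, mul_assoc, h2]

/-- `Π_i |gnoFibreTrScale u i| = (1+u₁²)(1+u₂²)`. [folklore] -/
theorem prod_abs_gnoFibreTrScale (u : ℝ × ℝ) : ∏ i, |gnoFibreTrScale (L := L) u i| = (1 + u.1 ^ 2) * (1 + u.2 ^ 2) := by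
  rw [← prod_gnoFibreTrScale (L := L) u]
  exact Finset.prod_congr rfl fun i _ => abs_of_pos (gnoFibreTrScale_pos u i)

/-- The rescaling is a symmetric operator (diagonal in an orthonormal basis). [folklore] -/
theorem gnoScaleTrLin_isSymmetric (u : ℝ × ℝ) : (gnoScaleTrLin (L := L) u).IsSymmetric := by
  intro y w
  simp only [gnoScaleTrLin_apply, PiLp.inner_apply, gnoScaleTr_apply, RCLike.inner_apply, conj_trivial]
  exact Finset.sum_congr rfl fun i _ => by ring

/-- `‖gnoScaleTr u y‖ ≥ ‖y‖` (all weights `≥ 1`) — so the rescaled far region contains the plain one. [folklore] -/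
theorem norm_le_norm_gnoScaleTr (u : ℝ × ℝ) (y : GnoFibreB L) : ‖y‖ ≤ ‖gnoScaleTr u y‖ := by
  have h : ‖y‖ ^ 2 ≤ ‖gnoScaleTr u y‖ ^ 2 := by
    rw [EuclideanSpace.real_norm_sq_eq, EuclideanSpace.real_norm_sq_eq]
    refine Finset.sum_le_sum fun i _ => ?_
    rw [gnoScaleTr_apply, mul_pow]
    have h1 : 1 ≤ gnoFibreTrScale (L := L) u i ^ 2 := one_le_pow₀ (one_le_gnoFibreTrScale u i)
    nlinarith [sq_nonneg (y i)]
  exact (pow_le_pow_iff_left₀ (norm_nonneg _) (norm_nonneg _) two_ne_zero).1 h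

/-! ## §2 The letters of the rescaled chart point and of the rescaled direction -/

/-- The rescaled direction: `gnoFibreTrEmb u₂ (gnoScaleTr u y) = (y_δ, ((rotX(−arctan u₂)(c₁x₀, 0, c₁t₂), (0, c₂v₀, c₂v₁)), z, η_F)`, `c₁ = √(1+u₁²)`, `c₂ = √(1+u₂²)`.
[folklore] -/
theorem gnoFibreTrEmb_gnoScaleTr (u : ℝ × ℝ) (y : GnoFibreB L) :
    gnoFibreTrEmb u.2 (gnoScaleTr u y) = (y (Sum.inl (Sum.inl 0)),
      (((rotX (-Real.arctan u.2) (![Real.sqrt (1 + u.1 ^ 2) * y (Sum.inl (Sum.inl 1)), 0, Real.sqrt (1 + u.1 ^ 2) * y (Sum.inl (Sum.inl 2))] : Fin 3 → ℝ),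
          (![0, Real.sqrt (1 + u.2 ^ 2) * y (Sum.inl (Sum.inr 0)), Real.sqrt (1 + u.2 ^ 2) * y (Sum.inl (Sum.inr 1))] : Fin 3 → ℝ)),
        ((fun k => y (Sum.inr (Sum.inl k))), (fun f k => y (Sum.inr (Sum.inr (f, k)))))) : GnoCoord L)) := by
  rw [gnoFibreTrEmb_apply]
  simp only [gnoScaleTr_apply, gnoFibreTrScale, Sum.elim_inl, Sum.elim_inr, Matrix.cons_val_zero, Matrix.cons_val_one, Matrix.cons_val_two,
    Matrix.head_cons, Matrix.tail_cons, one_mul]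

/-- The rescaled chart point: `gnoFibreTrEquiv (u, gnoScaleTr u y) = (y_δ, ((rotX(−arctan u₂)(c₁x₀, u₁, c₁t₂), (u₂, c₂v₀, c₂v₁)), z, η_F)`. [folklore] -/
theorem gnoFibreTrEquiv_gnoScaleTr (u : ℝ × ℝ) (y : GnoFibreB L) :
    gnoFibreTrEquiv (u, gnoScaleTr u y) = (y (Sum.inl (Sum.inl 0)),
      (((rotX (-Real.arctan u.2) (![Real.sqrt (1 + u.1 ^ 2) * y (Sum.inl (Sum.inl 1)), u.1, Real.sqrt (1 + u.1 ^ 2) * y (Sum.inl (Sum.inl 2))] : Fin 3 → ℝ),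
          (![u.2, Real.sqrt (1 + u.2 ^ 2) * y (Sum.inl (Sum.inr 0)), Real.sqrt (1 + u.2 ^ 2) * y (Sum.inl (Sum.inr 1))] : Fin 3 → ℝ)),
        ((fun k => y (Sum.inr (Sum.inl k))), (fun f k => y (Sum.inr (Sum.inr (f, k)))))) : GnoCoord L)) := by
  rw [gnoFibreTrEquiv_apply']
  simp only [gnoScaleTr_apply, gnoFibreTrScale, Sum.elim_inl, Sum.elim_inr, Matrix.cons_val_zero, Matrix.cons_val_one, Matrix.cons_val_two,
    Matrix.head_cons, Matrix.tail_cons, one_mul]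

/-- The hub letter of the rescaled chart point is `y_δ` (unscaled). [folklore] -/
theorem gnoFibreTrEquiv_gnoScaleTr_fst (u : ℝ × ℝ) (y : GnoFibreB L) : (gnoFibreTrEquiv (u, gnoScaleTr u y)).1 = y (Sum.inl (Sum.inl 0)) := by
  rw [gnoFibreTrEquiv_fst, gnoScaleTr_apply, (gnoFibreTrScale_apply (L := L) u).1, one_mul]

/-! ## §3 The amplitude in the rescaled letters -/

omit [NeZero L] in
/-- `w(rotX θ (c₁x₀, u₁, c₁t₂)) = w(0, u₁, 0)·w(x₀, 0, t₂)`, `c₁ = √(1+u₁²)`: the `x`-leader weight FACTORISES into base and fibre parts (`1+|x|² = (1+u₁²)(1+x₀²+t₂²)`,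
the rotation does not change `|x|²`). [folklore] -/
theorem gnomonicWeight_trRescaledX (θ x₀ t₂ u₁ : ℝ) :
    gnomonicWeight (rotX θ (![Real.sqrt (1 + u₁ ^ 2) * x₀, u₁, Real.sqrt (1 + u₁ ^ 2) * t₂] : Fin 3 → ℝ)) =
      gnomonicWeight (![0, u₁, 0] : Fin 3 → ℝ) * gnomonicWeight (![x₀, 0, t₂] : Fin 3 → ℝ) := by
  rw [gnomonicWeight_rotX]
  have hc : Real.sqrt (1 + u₁ ^ 2) ^ 2 = 1 + u₁ ^ 2 := Real.sq_sqrt (by positivity)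
  simp only [gnomonicWeight, normSq3, Fin.sum_univ_three, Matrix.cons_val_zero, Matrix.cons_val_one, Matrix.cons_val_two, Matrix.head_cons, Matrix.tail_cons]
  rw [mul_pow, mul_pow, hc]
  have h1 : (0 : ℝ) < 1 + u₁ ^ 2 := by positivity
  have h2 : (0 : ℝ) < 1 + (x₀ ^ 2 + t₂ ^ 2) := by positivity
  field_simp
  ring

omit [NeZero L] in
/-- `w(u₂, c₂v₀, c₂v₁) = w(u₂, 0, 0)·w(0, v₀, v₁)`, `c₂ = √(1+u₂²)`: the `y`-leader weight factorises likewise. [folklore] -/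
theorem gnomonicWeight_trRescaledY (v₀ v₁ u₂ : ℝ) :
    gnomonicWeight (![u₂, Real.sqrt (1 + u₂ ^ 2) * v₀, Real.sqrt (1 + u₂ ^ 2) * v₁] : Fin 3 → ℝ) =
      gnomonicWeight (![u₂, 0, 0] : Fin 3 → ℝ) * gnomonicWeight (![0, v₀, v₁] : Fin 3 → ℝ) := by
  have hc : Real.sqrt (1 + u₂ ^ 2) ^ 2 = 1 + u₂ ^ 2 := Real.sq_sqrt (by positivity)
  simp only [gnomonicWeight, normSq3, Fin.sum_univ_three, Matrix.cons_val_zero, Matrix.cons_val_one, Matrix.cons_val_two, Matrix.head_cons, Matrix.tail_cons]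
  rw [mul_pow, mul_pow, hc]
  have h1 : (0 : ℝ) < 1 + u₂ ^ 2 := by positivity
  have h2 : (0 : ℝ) < 1 + (v₀ ^ 2 + v₁ ^ 2) := by positivity
  field_simp
  ring

/-- ★ **THE 001 AMPLITUDE FACTORISES**: `J(Ψ(u, gnoScaleTr u y)) = w(0,u₁,0)·w(u₂,0,0) · g(y)` with the `u`-FREE fibre weight
`g(y) = ((1+y_δ²)⁻¹)²·w(x₀,0,t₂)·w(0,v₀,v₁)·w(z)·∏_f w(η_f)` (`J(δ, η) = ((1+δ²)⁻¹)²ρ(η)`). [folklore] -/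
theorem trDensity_rescaled_eq (u : ℝ × ℝ) (y : GnoFibreB L) :
    ((1 + (gnoFibreTrEquiv (u, gnoScaleTr u y)).1 ^ 2)⁻¹) ^ 2 * gnoDensity (gnoFibreTrEquiv (u, gnoScaleTr u y)).2 =
      gnomonicWeight (![0, u.1, 0] : Fin 3 → ℝ) * gnomonicWeight (![u.2, 0, 0] : Fin 3 → ℝ) *
        (((1 + y (Sum.inl (Sum.inl 0)) ^ 2)⁻¹) ^ 2 *
          (gnomonicWeight (![y (Sum.inl (Sum.inl 1)), 0, y (Sum.inl (Sum.inl 2))] : Fin 3 → ℝ) *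
            gnomonicWeight (![0, y (Sum.inl (Sum.inr 0)), y (Sum.inl (Sum.inr 1))] : Fin 3 → ℝ) *
            gnomonicWeight (fun k => y (Sum.inr (Sum.inl k))) * piWeight (fun f k => y (Sum.inr (Sum.inr (f, k)))))) := by
  rw [gnoFibreTrEquiv_gnoScaleTr]
  simp only [gnoDensity]
  rw [gnomonicWeight_trRescaledX, gnomonicWeight_trRescaledY]
  ring

/-- ★ **THE FIBRE PART OF THE 001 AMPLITUDE**: `1 − 2‖y‖² ≤ g(y) ≤ 1` and `0 < g(y)` (five gnomonic weights, each in `[1 − 2|letter|², 1]`: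
✓`one_sub_two_mul_le_gnomonicWeight`, ✓`piWeight_ge_one_sub`). [folklore] -/
theorem trFibreWeight_bounds (y : GnoFibreB L) :
    1 - 2 * ‖y‖ ^ 2 ≤ ((1 + y (Sum.inl (Sum.inl 0)) ^ 2)⁻¹) ^ 2 *
          (gnomonicWeight (![y (Sum.inl (Sum.inl 1)), 0, y (Sum.inl (Sum.inl 2))] : Fin 3 → ℝ) *
            gnomonicWeight (![0, y (Sum.inl (Sum.inr 0)), y (Sum.inl (Sum.inr 1))] : Fin 3 → ℝ) *
            gnomonicWeight (fun k => y (Sum.inr (Sum.inl k))) * piWeight (fun f k => y (Sum.inr (Sum.inr (f, k))))) ∧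
      ((1 + y (Sum.inl (Sum.inl 0)) ^ 2)⁻¹) ^ 2 *
          (gnomonicWeight (![y (Sum.inl (Sum.inl 1)), 0, y (Sum.inl (Sum.inl 2))] : Fin 3 → ℝ) *
            gnomonicWeight (![0, y (Sum.inl (Sum.inr 0)), y (Sum.inl (Sum.inr 1))] : Fin 3 → ℝ) *
            gnomonicWeight (fun k => y (Sum.inr (Sum.inl k))) * piWeight (fun f k => y (Sum.inr (Sum.inr (f, k))))) ≤ 1 ∧
      0 < ((1 + y (Sum.inl (Sum.inl 0)) ^ 2)⁻¹) ^ 2 *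
          (gnomonicWeight (![y (Sum.inl (Sum.inl 1)), 0, y (Sum.inl (Sum.inl 2))] : Fin 3 → ℝ) *
            gnomonicWeight (![0, y (Sum.inl (Sum.inr 0)), y (Sum.inl (Sum.inr 1))] : Fin 3 → ℝ) *
            gnomonicWeight (fun k => y (Sum.inr (Sum.inl k))) * piWeight (fun f k => y (Sum.inr (Sum.inr (f, k))))) := by
  -- the δ factor is a gnomonic weight too
  have eδ : ((1 + y (Sum.inl (Sum.inl 0)) ^ 2)⁻¹) ^ 2 = gnomonicWeight (![y (Sum.inl (Sum.inl 0)), 0, 0] : Fin 3 → ℝ) := by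
    simp [gnomonicWeight, normSq3, Fin.sum_univ_three]
  rw [eδ]
  set wδ := gnomonicWeight (![y (Sum.inl (Sum.inl 0)), 0, 0] : Fin 3 → ℝ) with hwδ
  set wx := gnomonicWeight (![y (Sum.inl (Sum.inl 1)), 0, y (Sum.inl (Sum.inl 2))] : Fin 3 → ℝ) with hwx
  set wy := gnomonicWeight (![0, y (Sum.inl (Sum.inr 0)), y (Sum.inl (Sum.inr 1))] : Fin 3 → ℝ) with hwy
  set wz := gnomonicWeight (fun k => y (Sum.inr (Sum.inl k))) with hwz
  set wF := piWeight (fun f k => y (Sum.inr (Sum.inr (f, k)))) with hwF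
  have hpos : 0 < wδ * (wx * wy * wz * wF) :=
    mul_pos (gnomonicWeight_pos _) (mul_pos (mul_pos (mul_pos (gnomonicWeight_pos _) (gnomonicWeight_pos _)) (gnomonicWeight_pos _)) (piWeight_pos _))
  -- letter squares
  have nδ : normSq3 (![y (Sum.inl (Sum.inl 0)), 0, 0] : Fin 3 → ℝ) = y (Sum.inl (Sum.inl 0)) ^ 2 := by simp [normSq3, Fin.sum_univ_three]
  have nx : normSq3 (![y (Sum.inl (Sum.inl 1)), 0, y (Sum.inl (Sum.inl 2))] : Fin 3 → ℝ) = y (Sum.inl (Sum.inl 1)) ^ 2 + y (Sum.inl (Sum.inl 2)) ^ 2 := by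
    simp [normSq3, Fin.sum_univ_three]
  have ny : normSq3 (![0, y (Sum.inl (Sum.inr 0)), y (Sum.inl (Sum.inr 1))] : Fin 3 → ℝ) = y (Sum.inl (Sum.inr 0)) ^ 2 + y (Sum.inl (Sum.inr 1)) ^ 2 := by
    simp [normSq3, Fin.sum_univ_three]
  have hδ1 := one_sub_two_mul_le_gnomonicWeight (![y (Sum.inl (Sum.inl 0)), 0, 0] : Fin 3 → ℝ)
  have hx1 := one_sub_two_mul_le_gnomonicWeight (![y (Sum.inl (Sum.inl 1)), 0, y (Sum.inl (Sum.inl 2))] : Fin 3 → ℝ)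
  have hy1 := one_sub_two_mul_le_gnomonicWeight (![0, y (Sum.inl (Sum.inr 0)), y (Sum.inl (Sum.inr 1))] : Fin 3 → ℝ)
  have hz1 := one_sub_two_mul_le_gnomonicWeight (fun k => y (Sum.inr (Sum.inl k)))
  have hF1 := piWeight_ge_one_sub (fun f k => y (Sum.inr (Sum.inr (f, k))))
  rw [nδ, ← hwδ] at hδ1
  rw [nx, ← hwx] at hx1
  rw [ny, ← hwy] at hy1
  rw [← hwz] at hz1
  rw [← hwF] at hF1
  have hN := norm_sq_gnoFibreB_letters y
  obtain ⟨N0, hN0⟩ : ∃ r : ℝ, r = y (Sum.inl (Sum.inl 0)) ^ 2 := ⟨_, rfl⟩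
  obtain ⟨N1, hN1⟩ : ∃ r : ℝ, r = y (Sum.inl (Sum.inl 1)) ^ 2 + y (Sum.inl (Sum.inl 2)) ^ 2 := ⟨_, rfl⟩
  obtain ⟨N2, hN2⟩ : ∃ r : ℝ, r = y (Sum.inl (Sum.inr 0)) ^ 2 + y (Sum.inl (Sum.inr 1)) ^ 2 := ⟨_, rfl⟩
  obtain ⟨N3, hN3⟩ : ∃ r : ℝ, r = normSq3 (fun k => y (Sum.inr (Sum.inl k))) := ⟨_, rfl⟩
  obtain ⟨N4, hN4⟩ : ∃ r : ℝ, r = ∑ f, normSq3 (fun k => y (Sum.inr (Sum.inr (f, k)))) := ⟨_, rfl⟩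
  rw [← hN0] at hδ1; rw [← hN1] at hx1; rw [← hN2] at hy1; rw [← hN3] at hz1; rw [← hN4] at hF1
  have hN' : ‖y‖ ^ 2 = N0 + N1 + N2 + N3 + N4 := by rw [hN, hN0, hN1, hN2, hN3, hN4]; ring
  have h00 : 0 ≤ N0 := by rw [hN0]; exact sq_nonneg _
  have h01 : 0 ≤ N1 := by rw [hN1]; exact add_nonneg (sq_nonneg _) (sq_nonneg _)
  have h02 : 0 ≤ N2 := by rw [hN2]; exact add_nonneg (sq_nonneg _) (sq_nonneg _)
  have h03 : 0 ≤ N3 := by rw [hN3]; exact normSq3_nonneg _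
  have h04 : 0 ≤ N4 := by rw [hN4]; exact Finset.sum_nonneg fun f _ => normSq3_nonneg _
  have two0 : (0 : ℝ) ≤ 2 := by norm_num
  obtain ⟨s1, p1, q1⟩ := bWeight_mul_step (gnomonicWeight_pos _).le (gnomonicWeight_le_one _) (gnomonicWeight_pos _).le (gnomonicWeight_le_one _) hx1 hy1
    (mul_nonneg two0 h02)
  obtain ⟨s2, p2, q2⟩ := bWeight_mul_step p1 q1 (gnomonicWeight_pos _).le (gnomonicWeight_le_one _) s1 hz1 (mul_nonneg two0 h03)
  obtain ⟨s3, p3, q3⟩ := bWeight_mul_step p2 q2 (piWeight_pos _).le (piWeight_le_one _) s2 hF1 (mul_nonneg two0 h04)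
  have h123 : 0 ≤ 2 * N1 + 2 * N2 + 2 * N3 + 2 * N4 := by linarith
  obtain ⟨s4, -, q4⟩ := bWeight_mul_step (gnomonicWeight_pos _).le (gnomonicWeight_le_one _) p3 q3 hδ1 s3 h123
  refine ⟨?_, q4, hpos⟩
  rw [hN']; refine le_trans (le_of_eq ?_) s4; ring

/-- ★ **THE 001 BASE WEIGHT** `w₀(u) = w(0,u₁,0)·w(u₂,0,0)·((1+u₁²)(1+u₂²)) = (1+u₁²)⁻¹·(1+u₂²)⁻¹` (amplitude at the base times the Jacobian of the rescaling) is positive,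
measurable and INTEGRABLE on `ℝ²` (product of two Cauchy densities, ✓`integrable_inv_one_add_sq`; total mass `π²`). [folklore] -/
theorem trBaseWeight_facts :
    (∀ u : ℝ × ℝ, gnomonicWeight (![0, u.1, 0] : Fin 3 → ℝ) * gnomonicWeight (![u.2, 0, 0] : Fin 3 → ℝ) * ((1 + u.1 ^ 2) * (1 + u.2 ^ 2)) =
        (1 + u.1 ^ 2)⁻¹ * (1 + u.2 ^ 2)⁻¹) ∧
      (∀ u : ℝ × ℝ, 0 < (1 + u.1 ^ 2)⁻¹ * (1 + u.2 ^ 2)⁻¹) ∧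
      (Measurable fun u : ℝ × ℝ => (1 + u.1 ^ 2)⁻¹ * (1 + u.2 ^ 2)⁻¹) ∧
      Integrable (fun u : ℝ × ℝ => (1 + u.1 ^ 2)⁻¹ * (1 + u.2 ^ 2)⁻¹) := by
  refine ⟨fun u => ?_, fun u => by positivity, ?_, ?_⟩
  · have h1 : (0 : ℝ) < 1 + u.1 ^ 2 := by positivity
    have h2 : (0 : ℝ) < 1 + u.2 ^ 2 := by positivity
    simp only [gnomonicWeight, normSq3, Fin.sum_univ_three, Matrix.cons_val_zero, Matrix.cons_val_one, Matrix.cons_val_two, Matrix.head_cons, Matrix.tail_cons]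
    field_simp
    ring
  · exact ((measurable_const.add (measurable_fst.pow_const 2)).inv).mul ((measurable_const.add (measurable_snd.pow_const 2)).inv)
  · have h := (integrable_inv_one_add_sq).mul_prod (integrable_inv_one_add_sq)
    rw [← Measure.volume_eq_prod] at h
    exact h

/-! ## §4 The far floor in the rescaled chart: w3 g67's ✓`tr001_far_floor` reads `‖y‖²` -/

omit [NeZero L] in
/-- The flat-direction bookkeeping of the skew rotation: for `x = rotX(−arctan u₂)(a, u₁, b)` and `y₀ = u₂`,
`x₁y₀ + x₂ = √(1+u₂²)·b` and `x₁ − y₀x₂ = √(1+u₂²)·u₁`. [folklore] -/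
theorem rotX_negArctan_letters (a b u₁ u₂ : ℝ) :
    rotX (-Real.arctan u₂) (![a, u₁, b] : Fin 3 → ℝ) 1 * u₂ + rotX (-Real.arctan u₂) (![a, u₁, b] : Fin 3 → ℝ) 2 = Real.sqrt (1 + u₂ ^ 2) * b ∧
      rotX (-Real.arctan u₂) (![a, u₁, b] : Fin 3 → ℝ) 1 - u₂ * rotX (-Real.arctan u₂) (![a, u₁, b] : Fin 3 → ℝ) 2 = Real.sqrt (1 + u₂ ^ 2) * u₁ := by
  have hc : Real.cos (-Real.arctan u₂) = 1 / Real.sqrt (1 + u₂ ^ 2) := by rw [Real.cos_neg, Real.cos_arctan]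
  have hs : Real.sin (-Real.arctan u₂) = -(u₂ / Real.sqrt (1 + u₂ ^ 2)) := by rw [Real.sin_neg, Real.sin_arctan]
  have hq0 : 0 < Real.sqrt (1 + u₂ ^ 2) := Real.sqrt_pos.2 (by positivity)
  have hq2 : Real.sqrt (1 + u₂ ^ 2) ^ 2 = 1 + u₂ ^ 2 := Real.sq_sqrt (by positivity)
  simp only [rotX, Matrix.cons_val_zero, Matrix.cons_val_one, Matrix.cons_val_two, Matrix.head_cons, Matrix.tail_cons, hc, hs]
  constructor
  · field_simp
    rw [hq2]; ring
  · field_simp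
    rw [hq2]; ring

/-- ★ **w3 g67's rescaled 001 fibre norm IS `‖y‖²` in the rescaled chart**: at `(δ, η) = Ψ(u, gnoScaleTr u y)` the quantity
`δ² + ((1+y₀²)x₀² + w²)∕((1+y₀²) + v′²) + |y⊥|²∕(1+y₀²) + |z|² + Σ_f|η_f|²` of ✓`tr001_global_floor` equals `‖y‖²`. [folklore] -/
theorem tr001_rescaledNormSq_eq (u : ℝ × ℝ) (y : GnoFibreB L) :
    (gnoFibreTrEquiv (u, gnoScaleTr u y)).1 ^ 2 +
        ((1 + ((gnoFibreTrEquiv (u, gnoScaleTr u y)).2.1.2 0) ^ 2) * ((gnoFibreTrEquiv (u, gnoScaleTr u y)).2.1.1 0) ^ 2 +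
            ((gnoFibreTrEquiv (u, gnoScaleTr u y)).2.1.1 1 * (gnoFibreTrEquiv (u, gnoScaleTr u y)).2.1.2 0 + (gnoFibreTrEquiv (u, gnoScaleTr u y)).2.1.1 2) ^ 2) /
          ((1 + ((gnoFibreTrEquiv (u, gnoScaleTr u y)).2.1.2 0) ^ 2) +
            ((gnoFibreTrEquiv (u, gnoScaleTr u y)).2.1.1 1 - (gnoFibreTrEquiv (u, gnoScaleTr u y)).2.1.2 0 * (gnoFibreTrEquiv (u, gnoScaleTr u y)).2.1.1 2) ^ 2) +
        (((gnoFibreTrEquiv (u, gnoScaleTr u y)).2.1.2 1) ^ 2 + ((gnoFibreTrEquiv (u, gnoScaleTr u y)).2.1.2 2) ^ 2) / (1 + ((gnoFibreTrEquiv (u, gnoScaleTr u y)).2.1.2 0) ^ 2) +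
        (((gnoFibreTrEquiv (u, gnoScaleTr u y)).2.2.1 0) ^ 2 + ((gnoFibreTrEquiv (u, gnoScaleTr u y)).2.2.1 1) ^ 2 + ((gnoFibreTrEquiv (u, gnoScaleTr u y)).2.2.1 2) ^ 2) +
        ∑ i : Fol L, (((gnoFibreTrEquiv (u, gnoScaleTr u y)).2.2.2 i 0) ^ 2 + ((gnoFibreTrEquiv (u, gnoScaleTr u y)).2.2.2 i 1) ^ 2 +
          ((gnoFibreTrEquiv (u, gnoScaleTr u y)).2.2.2 i 2) ^ 2) = ‖y‖ ^ 2 := by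
  obtain ⟨hw, hv⟩ := rotX_negArctan_letters (Real.sqrt (1 + u.1 ^ 2) * y (Sum.inl (Sum.inl 1))) (Real.sqrt (1 + u.1 ^ 2) * y (Sum.inl (Sum.inl 2))) u.1 u.2
  rw [gnoFibreTrEquiv_gnoScaleTr, norm_sq_gnoFibreB_letters]
  simp only [Matrix.cons_val_zero, Matrix.cons_val_one, Matrix.cons_val_two, Matrix.head_cons, Matrix.tail_cons]
  rw [hw, hv]
  have h0 : rotX (-Real.arctan u.2) (![Real.sqrt (1 + u.1 ^ 2) * y (Sum.inl (Sum.inl 1)), u.1, Real.sqrt (1 + u.1 ^ 2) * y (Sum.inl (Sum.inl 2))] : Fin 3 → ℝ) 0 =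
      Real.sqrt (1 + u.1 ^ 2) * y (Sum.inl (Sum.inl 1)) := rfl
  rw [h0]
  have hp2 : Real.sqrt (1 + u.1 ^ 2) ^ 2 = 1 + u.1 ^ 2 := Real.sq_sqrt (by positivity)
  have hq2 : Real.sqrt (1 + u.2 ^ 2) ^ 2 = 1 + u.2 ^ 2 := Real.sq_sqrt (by positivity)
  have hx : ((1 + u.2 ^ 2) * (Real.sqrt (1 + u.1 ^ 2) * y (Sum.inl (Sum.inl 1))) ^ 2 + (Real.sqrt (1 + u.2 ^ 2) * (Real.sqrt (1 + u.1 ^ 2) * y (Sum.inl (Sum.inl 2)))) ^ 2) /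
      ((1 + u.2 ^ 2) + (Real.sqrt (1 + u.2 ^ 2) * u.1) ^ 2) = y (Sum.inl (Sum.inl 1)) ^ 2 + y (Sum.inl (Sum.inl 2)) ^ 2 := by
    rw [div_eq_iff (by positivity)]
    rw [mul_pow, mul_pow, mul_pow, mul_pow, hp2, hq2]
    ring
  have hyp : ((Real.sqrt (1 + u.2 ^ 2) * y (Sum.inl (Sum.inr 0))) ^ 2 + (Real.sqrt (1 + u.2 ^ 2) * y (Sum.inl (Sum.inr 1))) ^ 2) / (1 + u.2 ^ 2) =
      y (Sum.inl (Sum.inr 0)) ^ 2 + y (Sum.inl (Sum.inr 1)) ^ 2 := by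
    rw [div_eq_iff (by positivity), mul_pow, mul_pow, hq2]
    ring
  rw [hx, hyp]
  simp only [normSq3, Fin.sum_univ_three]
  ring

/-- ★★ **THE 001 FAR-FLOOR SOCKET IN THE RESCALED CHART**: for `0 ≤ R ≤ 1` and `R ≤ ‖y‖`,
`R²∕(10816·(1+|Fol L|)·L⁶) ≤ F̂₁(Ψ(u, gnoScaleTr u y))`, `F̂₁(δ, η) = trGnoDeficit uJ z₁ (sectorChar z₁) (hubAt δ 1) ε η` — EVERY base point `u ∈ ℝ²`, EVERY sign pattern
(w3 g67's ✓`tr001_far_floor` ∘ `tr001_rescaledNormSq_eq`). [cite: Luscher1983, §2] -/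
theorem tr001_hfar_rescaled (ε : GnoSign L) (u : ℝ × ℝ) (y : GnoFibreB L) {R : ℝ} (hR0 : 0 ≤ R) (hR1 : R ≤ 1) (hy : R ≤ ‖y‖) :
    R ^ 2 / (10816 * (1 + (Fintype.card (Fol L) : ℝ)) * (L : ℝ) ^ 6) ≤
      trGnoDeficit uJ z₁ (sectorChar z₁) (hubAt (gnoFibreTrEquiv (u, gnoScaleTr u y)).1 1) ε (gnoFibreTrEquiv (u, gnoScaleTr u y)).2 := by
  refine tr001_far_floor (L := L) (gnoFibreTrEquiv (u, gnoScaleTr u y)).1 R hR0 hR1 ε (gnoFibreTrEquiv (u, gnoScaleTr u y)).2 ?_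
  rw [tr001_rescaledNormSq_eq]
  exact pow_le_pow_left₀ hR0 hy 2

end Summit.QuantumFields.YangMills.Theorems.SwapVirialDeficit.BlowUpRing

end
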